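import Summits.RiemannHypothesis.RiemannHypothesis.Theorems.TiltedLandingLaw421R3TouchedDissipationW

/-! # TiltedLandingLaw421R3TouchedDissipationWInstance — the INSTANCE OF RECORD `T⁗★` of the frame-weighted touched-pair dissipation law (lens-2 g7)

ONE import: module 1 `…R3TouchedDissipationW` (tree #1194: the constant-free SOCKET `TouchedDissipationLawWQ`, the weight `frameWeightQ θ` over the TREE
budget `B`, `TouchedDissipationLawTQ c L κ₀ θ`, `thetaW := 2`, monotonicity).  This file adds ONLY the numeric instance chosen AFTER CUT 34 / CUT 35 /
E3 / E4 ((CA690)(C), (CA692)(A), (CA694)(C): «ONE added Instance file, ONE instance line after E3, never an edit of 40/41»), its admissibility lemma and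
the downward transport.  The numbers in the docstrings are certificates / bench floats of record (crit-1 CUT 34 + CORRECTION «W2F-high» l.8268 + MEMBER
CERTIFICATES l.8286 = (CA696); instr-1 g8 E3 `INSTRUMENT-v3-TPRICE4.md` §E3 and E4 §E4 (floats); C6 CUT 35 scout) — NOT proofs.  A re-fit is
another instance, transported by `lawTQ_of_lawTStar` / `lawTQ_mono_theta`, never an edit of module 1 or 2 or of this file's decls.
WHAT E3 SHOWED ABOUT THE SOCKET (closed forms, any instance): (A) the STIFF-TILT TANGENT CORNER (|F| → ∞, toucher level with `v` and laterally tangent,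
`u → 2` ⇒ `logWeight = 1` ∀L, `w_F = 1` ∀θ) has `M·w_F → X″ → 3⁺` — the socket's constant is CAPPED BELOW 3 for every (L, θ, Hs-reading); at `c = 2` the
infimum margin is ×1.5, flat in L; this corner IS RUNG-P's regime (ρ → 1, λ → ∞: `X ≥ 3 − 15/λ`), the provable end.  (B) the TALL SPARSE FENCE (λ_v 3–3.6,
(R, Hs) re-tuned so that `Hs = √(θRs)` neutralises `w_F` at log cost `u_eff = E/(θRs)`) is the open end: `M·w_F` = 2.63 (L .25) … 4.10 (L .35), rising in L;
L = 0 DEAD (×0.43 'free'), L ≥ .83 DEAD (corner).  Hence every admissible instance has `c < 3` and `L ∈ [.29, .82)`.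
RETOUCH-COUNT EXPOSURE ((CA681)(D)/(CA692)(A)): Γ3′ `TouchRiseLawWQ cF L κ₀ aT` makes `aT F` absorb `Σ_k RTB_k` over EVERY charged retouch of the tracked
lineage; `k` is bounded by nothing typed.  MEASURED (instr-1 E4 float scout, 12 designs on the exact replayer): `k_realised ∈ {0, 1}` in 12/12 (≥ 2 storeys ⇒
TiltReady at level 0; simple tall movers co-drift ⇒ no touch episode), max `Σ RTB/P = 0.183` on the K = 1 frame of record; the fence-pinned low-band regime
(ρ 2–4) untested at this writing (crit-1's ladder).  FUNDING DIRECTION (erratum to v3's trigger line): retouches are paid from the FIT spare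
`(0.656 − φ₀)·(Hs/s)² + (3/2 − φ₀θ)·(B+1)`, so MORE retouches need a SMALLER φ₀ = (1+2L+2L²)/(2c), i.e. `c` LARGER (toward the corner cap 3, law margin ↓)
or `L` smaller (law margin ↓ on fence/members) or `aT` B-funded; `k = 2` per lineage (≈ 0.37·P) is fundable by NO admissible (c, L) from the P-bracket
(needs φ₀ ≤ 0.29 ⇒ c ≥ 2.7–3.2) ⇒ crit-1's KILL SIGN «k_realised ≥ 3 charged above allowance» is a kill of the FIT, and k = 2 generic already forces
B-funding.
Nothing here bears on the truth of RH; RH is not proved; T⁗★ is a TYPED, UNPROVED law; Γ3′ / Γ4 / FIT debits priced only by benches; C′ typed not proved;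
★A / 33346 / 33347 OPEN; certificates ≠ Lean; checked ≠ landed ≠ proved. -/

namespace RhW08.TouchedDissipationWStar

open RhW08.TouchedDissipationW

/-! ## The instance -/

/-- (LAW T⁗★ — THE INSTANCE OF RECORD) `T⁗(c = 2, L = 3/10, κ₀ = 3, θ = thetaW = 2)`.  The law holds on a bench row iff `M·w_F ≥ c = 2` with
`M = X″·(1 + L·log(2/u))²`, `X″ = η²ΔE/s²`, `u = E/Hs²`, `w_F = max(1, 2(B+1)(s/Hs)²)`, `B` in TREE currency; MEMBERSHIP = the typed `Charged` incl.
`SuccOf (1/4)` (a level is un-charged as soon as some level-1 state sits `≥ s/4` below the lowest state).  MARGIN TABLE at L = 0.30: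
(A) CORNER: ×1.5 infimum (closed form `X″ → 3`, L-free; instr-1 E3 hunt row F −603.6, d 1.999, b 1.00021: X″ 3.029, w_F 1, measured ×1.515).
(B) FENCE (one-sided, tall sparse, (R, Hs) re-tuned adversarially, floats): `M·w_F` ≈ 3.3 ⇒ ×1.65 (instr-1: D_B rising in L, 2.14·1.231 at .25,
2.78·1.474 at .35); at the census R with Hs = Hmax every gen-7 row has
`M·w_F ≥ 2.9` at L ≥ .25 (rowR_u023: B ≥ 11 733 ⇒ w_F ≥ 26 ⇒ × ≥ 19).
(BALANCED MEMBERS, w_F = 1, frame «W2F-high» = u023 fence + pair v = i/10, z = 1/5 + 51i/500 + two-sided comb sea ±ih with the AtomicPair-minimal hole,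
F = −46, R = 1000, s = 1/100; script `rh33346-cover/crit-g5/cut35/cert_member.py` 07f0de4e; every typed clause certified per member; margins by
arithmetic M(.30) = X″·(1 + 0.3·ln(2/u))² on crit-1's CERTIFIED X″, u (l.8286; certified brackets M(.25) ≤ M(.30) ≤ M(.35) = 2.9971/3.9017 on h .30;
stamp of the .30 column asked l.8350)):
h = .20 ×2.118 · .25 ×1.873 · **.30 ×1.717 (B 208, u .22671, X″ 1.256693, κ_v 166.71, rem 46.786 ≤ 50; out 33355f24; M(.30) = 3.4345); same member at
F = −49.9 (legal from R ≈ 8000: rem 49.998): X″ 1.209356, M(.30) = 3.3051 ⇒ ×1.653 = MIN (0c406145)** · .50 ×1.880 (u .0816) · 1.0 ×2.106 (u .0204) ·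
1.5 ×2.280 (u .00907).  NON-MEMBERS: h ≤ .16 (h = .16: a sea-edge child at Im ≤ .0975 ⇒ SuccOf(1/4), cert d858941d; h ≤ .14 incl. the former float
«W2F of record»
h = .12); h ≥ 1.7 READY.  Members start in (.16, .20].  PESSIMISTIC reading (w_F := 1 everywhere): the census one-sided rows at fixed R fail (u023
×0.74·…) — the weight is load-bearing there BY DESIGN; after adversarial (R, Hs) re-tuning the weight's net effect is the log penalty `u_eff` only (E3.3).
«L = 0» is CERTIFIED DEAD (FIT_W(θ 2.5): h 1.0 ×0.985, h 1.5 ×0.877; E3: ×0.43) and «L ≥ .83» is dead at the corner: the log profile is load-bearing and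
bounded on both sides.  PURSE: `φ₀★ = 89/200 = 0.445` ⇒ P-bracket spare 0.211·(Hs/s)² of the 0.656 allowance, B-bracket `φ₀★·θ ≤ 3/2` ⇒ 0.61·(B+1) spare,
both shared by Γ3′'s `aT` (one charged full-band retouch ≈ 0.183·P measured, k ≤ 1 structurally) and Γ4's `aRest` (to ride the same potential per
`lens2/GAMMA4-SCOPE-MEMO-v2.md`, benches E5/E6).  WHY (2, 3/10) rather than gen 7's provisional 7/20 (ONE instance line after E3/E4, (CA694)(C)): the
law's minimum margin is ×1.5 at the corner for EVERY L ∈ [.29, .6] (E3), so L buys nothing for the law above .29 while the purse factor φ₀ =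
(1+2L+2L²)/4 grows; 3/10 is the smallest round L at which fence and members stay above the corner (×1.65 / ×1.653) and it lifts the P-spare from 0.170
to 0.211·(Hs/s)² ≥ the measured one-retouch price r = 0.183 (instr-1 E4 float, k = 1; crit-1 ladder) with 0.028·P left for aRest — at 7/20 the k = 1
retouch is NOT funded from the P-bracket (0.170 < 0.183).  RE-FIT TRIGGERS (each = ONE new instance FILE superseding this one, never an
edit): a certified member or fence margin < ×1.5 ⇒ L ↑ within [.29, .6]; a certified ladder with r > 0.211 at k = 1, or k = 2 generic ⇒ aT B-funded in
FIT_W (no (c, L) helps) and, failing that, the FIT is dead; E5(b) balanced non-atomic min ≥ 2 ⇒ the socket's `AtomicPair` binder becomes droppable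
(★A rev 8, a different SOCKET, not an instance). -/
def TouchedDissipationLawTStarQ : Prop := TouchedDissipationLawTQ 2 (3 / 10) 3 thetaW

/-- (K) the instance constants are admissible and the purse factor is `φ₀★ = 89/200`. -/
theorem lawTStar_consts :
    (0 : ℝ) < 2 ∧ (0 : ℝ) ≤ 3 / 10 ∧ (0 : ℝ) < 3 ∧ (0 : ℝ) ≤ thetaW ∧
      (1 + 2 * (3 / 10 : ℝ) + 2 * (3 / 10) ^ 2) / (2 * 2) = 89 / 200 := by
  unfold thetaW; norm_num

/-- (K) T⁗★ transports to every weaker instance: `0 ≤ c ≤ 2`, `3 ≤ κ₀`, `thetaW ≤ θ`, same `L = 3/10`. -/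
theorem lawTQ_of_lawTStar {c κ₀ θ : ℝ} (hc0 : 0 ≤ c) (hc : c ≤ 2) (hκ : 3 ≤ κ₀) (hθ : thetaW ≤ θ)
    (h : TouchedDissipationLawTStarQ) : TouchedDissipationLawTQ c (3 / 10) κ₀ θ :=
  lawTQ_mono_theta hc0 hc hκ hθ h

/-- (K) in particular T⁗★ gives the `thetaW`-instance `TouchedDissipationLawTWQ c (3/10) κ₀` for every `0 ≤ c ≤ 2`, `3 ≤ κ₀`. -/
theorem lawTWQ_of_lawTStar {c κ₀ : ℝ} (hc0 : 0 ≤ c) (hc : c ≤ 2) (hκ : 3 ≤ κ₀) (h : TouchedDissipationLawTStarQ) :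
    TouchedDissipationLawTWQ c (3 / 10) κ₀ :=
  lawTQ_of_lawTStar hc0 hc hκ le_rfl h

end RhW08.TouchedDissipationWStar
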